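import Mathlib
import HarnessLib
import HarnessLib.Audit
import Summits.HodgeConjecture.Statement
import Literature.AlgebraicGeometry.HodgeTheory.ComplexGysin
import Literature.AlgebraicGeometry.Motives.Sweep1
import HarnessLib.Audit.Status.Attr

/-!
Route: CurveNetMordellWeil

Route CurveNetMordellWeil (card HodgeConjecture/HodgeConjecture/curve-nets-jacobian-coefficients) —
"Weil II for Hodge": slice X into CURVES over a projective space; Hodge classes are algebraic modulo
VERTICAL ones, and on FOURFOLDS one Deligne-descent step lands the vertical part on Lefschetz (1,1)
— Mordell–Weil classes of Jacobian fibrations over surfaces T ⊂ ℙ³; the dimensions above four are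
the shared dimension ladder.

THESIS X (words; repaired 2026-08-17). (i) FOURFOLD VERTICAL SUPPORT (crux
VerticalSupportFourfolds): for X smooth projective of dimension 4 over ℂ and pr : X → ℙ³ a
surjective morphism (a CURVE NET; every X acquires one after blowing up the reduced base points of a
general net of hypersurface sections: support CurveNetExists), every rational (2,2)-class c ∈
H⁴(X(ℂ);ℂ) is ALGEBRAIC MODULO VERTICAL HODGE CLASSES: c ∈ N²H⁴(X) + span{rational (2,2)-classes
vanishing on X ∖ pr⁻¹(T) for some proper Zariski-closed T ⊊ ℙ³} ("base-coniveau ≥ 1"). A vertical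
class is, by ONE descent step (support DeligneDescent, Hodge III 8.2.8 + semisimplicity), a Gysin
image of a rational (1,1)-class on a resolution of the threefold pr⁻¹(T) → T — a MORDELL–WEIL
(section / multisection) class of the Jacobian fibration over the surface T plus fibre components —
hence algebraic by Lefschetz (1,1). Leray picture (B° = ℙ³ ∖ T affine, T ⊇ hyperplane ∪ bad-fibre
locus): H⁴(B°, R⁰) = 0 (Artin), the R²-component is pr_*c|B° ∈ ℚh|B° = 0, so the obstruction is the
component of c in the TOP cohomology H³(B°, R¹pr_*ℚ) — cohomology of the base with JACOBIAN
(weight-one) coefficients, = the Hodge part of IH³(ℙ³, j_*R¹) modulo vertical — and (i) says it is a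
sum of Gysin images from surfaces of the base. (ii) THE LADDER (crux SummitGrantedFourfolds, SHARED
verbatim with route NoetherLefschetzOneUp, stmt-HodgeConjecture-14600): HC(4;2,2) for all smooth
projective fourfolds ⟹ Hodge models exist and every rational (p,p)-class is algebraic, in every
dimension (Lefschetz pencils below the middle and hard Lefschetz above it are theorems of the tree;
what is open is the middle degree of the even dimensions ≥ 6 granted all lower dimensions).
HISTORY OF THE REPAIR. The route was opened with vertical support in ALL dimensions, split by regime
— VerticalSupportMiddle (n = 2q), VerticalSupportBelowMiddle (2q < n), VerticalSupportAboveMiddle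
(2q > n) — and `closes` by induction on the codimension. The tree then PROVED `VerticalSupportMiddle
↔ HodgeConjecture` (Theorems.verticalSupportMiddle_iff_hodgeConjecture, 2026-08-17: the
middle-degree item is the summit in costume; its only registered line is complete except a heart
equal to HC), whereas the q = 2 instance (i) is equivalent to HC for fourfolds only
(Theorems.hodgeTwoTwo_le_algebraicClasses_of_verticalSupportFourfolds and its trivial converse). The
three regime items stay in the file as ASIDES (structural/negative knowledge cited by many Theorems)
and are no longer hypotheses of `closes`; likewise the calibration records AlgebraicInNormalForm /
CubicFourfoldNormalForm.
Lean (X = the conjunction of the two cruxes, constants in Literature.AlgebraicGeometry.Motives /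
.HodgeTheory): `(∀ ⦃X : SchemeOver ℂ⦄ (pr : X ⟶ projectiveSpace 3 ℂ), IsSmoothProjective 4 X →
Function.Surjective pr.left.base → Submodule.span ℂ {c : complexBetti X (2 * 2) | IsRationalClass c
∧ IsOfHodgeType 4 X (2 * 2) 2 2 c} ≤ algebraicClasses X 2 ⊔ Submodule.span ℂ {c : complexBetti X (2
* 2) | IsRationalClass c ∧ IsOfHodgeType 4 X (2 * 2) 2 2 c ∧ ∃ T : Set (projectiveSpace 3 ℂ).left,
IsClosed T ∧ T ≠ Set.univ ∧ complexBetti.restrictCompl X (pr.left.base ⁻¹' T) (2 * 2) c = 0}) ∧ ((∀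
⦃X : SchemeOver ℂ⦄, IsSmoothProjective 4 X → ∀ c : complexBetti X (2 * 2), IsRationalClass c →
IsOfHodgeType 4 X (2 * 2) 2 2 c → c ∈ algebraicClasses X 2) → ∀ ⦃n : ℕ⦄ ⦃X : SchemeOver ℂ⦄,
IsSmoothProjective n X → Nonempty (HodgeModel n X) ∧ ∀ (p : ℕ) (c : complexBetti X (2 * p)),
IsRationalClass c → IsOfHodgeType n X (2 * p) p p c → c ∈ algebraicClasses X p)` =
`VerticalSupportFourfolds ∧ SummitGrantedFourfolds`.

DECIDING THEOREM (D-0027 §2.1; route-repair 2026-08-17): `theorem closes : LefschetzOneOne →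
HodgeModels → ComplexOrientationExists → CurveNetExists → DeligneDescent → GysinPreservesAlgebraic →
VerticalSupportFourfolds → SummitGrantedFourfolds → HodgeConjecture` is PROVED in the route file
(sorry-free; axioms propext, Classical.choice, Quot.sound; no import beyond ComplexGysin / Sweep1):
fix μ (ComplexOrientationExists); for a fourfold X take the curve net (X', σ, pr : X' → ℙ³) of
CurveNetExists; VerticalSupportFourfolds splits a rational (2,2)-class on X' into algebraic +
vertical; DeligneDescent writes the vertical part as Gysin images g_*(β) of rational (d,d)-classes
with d + e = 2, e ≥ 1, so d ≤ 1 and β is algebraic by algebraicClasses_zero / LefschetzOneOne;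
GysinPreservesAlgebraic (d + e = 2) and the push-down σ_* (e = 0) give HC(4;2,2) on X;
SummitGrantedFourfolds returns HodgeConjectureFor n X for all n, X (Hodge models also from
HodgeModels). Four of the six supports are PROVED items (LefschetzOneOne, HodgeModels,
ComplexOrientationExists, GysinPreservesAlgebraic); DeligneDescent is closable now
(Theorems.deligneDescent_of_facts over the discharged Deligne1974 / Voisin2025 facts);
CurveNetExists has its construction files in progress
(Theorems/CurveNetMordellWeilCurveNetExists*.lean).

Rationale: WHY THIS LINE. (Card curve-nets-jacobian-coefficients; imports: Deligne's Weil II dévissage by curve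
fibrations with only R¹ = Jacobian coefficients [Deligne1980 §3]; Arapura's Leray cycle maps
[Arapura2022 Thm 1.2, Cor 1.4, READ pp. 2–5]; M. Saito's Hodge modules — Gr^F DR as coherent
complexes on the base, Saito–Kodaira vanishing [Saito1990]; de Cataldo–Migliorini's generic-flag
description of the perverse filtration [DecataldoMigliorini2010]; Zucker / M. Saito admissible
normal functions for the weight-one bottom [Zucker1977, KerrPearlstein2011 §3.1]; Deligne descent
[DeligneHodgeIII1974 8.2.8, Jannsen1990MixedMotives §7].) The documented death of the
Lefschetz–Griffiths induction is J^p(H) ≠ J^p(H)_alg for hyperplane sections (barrier Voisin2003…):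
slicing into CURVES instead means only Jacobians of curves (weight 1; Abel's theorem holds) ever
occur, and on a FOURFOLD the vertical classes are literally Mordell–Weil classes of Jacobian
fibrations over surfaces of ℙ³ — one descent step to Lefschetz (1,1), no intermediate Jacobian of
weight > 1, the net degree d a free parameter, the base ℙ³ with computable coherent cohomology
(Bott, Horrocks, Beilinson). REPAIR 2026-08-17 (badge, skeleton.hides-summit): the all-dimension
form of the thesis collapsed — the tree proved VerticalSupportMiddle ↔ HodgeConjecture (the
Stein-free transfer X × ℙ¹ × ℙ¹ → ℙ^{2q+1} makes middle-degree vertical support as strong as HC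
itself) — but its q = 2 instance VerticalSupportFourfolds is equivalent to HC for fourfolds ONLY
(hodgeTwoTwo_le_algebraicClasses_of_verticalSupportFourfolds + converse), which is where the
mechanism has teeth (Zucker's cubic fourfolds = plane-cubic elliptic fibration over ℙ³, a plane P ⊂
X being a section over π(P); Conte–Murre; Fermat sextic; Weil abelian fourfolds). So the deciding
theorem now runs: curve net + fourfold vertical support + ONE descent step + Lefschetz (1,1) ⟹
HC(4;2,2), then the dimension ladder SummitGrantedFourfolds (shared verbatim with
NoetherLefschetzOneUp, stmt-14600; Lefschetz pencils below the middle and hard Lefschetz above it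
are PROVED in the tree, hodgeConjecture_of_middleStep). What the tree already hands this route: HC —
all degrees — for every CH₀-degenerate fourfold
(Theorems.hodgeConjectureFor_of_chowZeroDegenerate_fourfold: Bloch–Srinivas + Voisin II 10.26,
unconditional since the degree formula and the spanning fact landed, p147912/p148125), so the
fourfold crux is open exactly for CH₀-NON-degenerate fourfolds (p_g > 0: K3×K3 with real
multiplication, Calabi–Yau, hyper-Kähler, general type); HC for hypersurface fourfolds of degree ≤
5; a Hodge-compatible Gysin / cycle-class formalism
(exists_gysinFormalism_isGysinHodgeCompatible_complexOrientation_holds); Deligne descent over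
discharged facts.
TWO-LAYER PLAN: no children filed. Foreseen glued split of the lead crux (prepared and probed by the
crux-strategist, Cruxes/VerticalSupportMiddle/SPLIT-PACKAGE.md, statements elaborate in the route
context): VerticalSupportFourfolds ⇐ HodgeFourfoldsChowDegenerate (THEOREM:
Theorems.hodgeFourfoldsChowDegenerate_holds) → HodgeFourfoldsHeart (HC(4;2,2) for CH₀-non-degenerate
fourfolds) → VerticalSupportFourfolds (4-line glue: by_cases + le_sup_left); to be filed by tenure
when a crux seat wants the heart as its own item. Registered lines on the lead crux:
anchor-transport-42, qbar-envelope-42; birth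
Cruxes/VerticalSupportMiddle/Lines/p2_fourfold_heart_birth.lean (CurveNetExists +
VerticalSupportFourfolds ⟹ heart, composition proved).
RANKED CRUXES. #4 VerticalSupportFourfolds (n = 4, q = 2, base ℙ³; THE LEAD CRUX after the repair; ⇔
HC(4;2,2) given the supports): every rational (2,2)-class on a curve-netted fourfold is algebraic
modulo classes supported over a surface T ⊂ ℙ³ = Mordell–Weil classes of the Jacobian fibration over
T; ENGINE (card): M^{2,2} = ℍ⁰(ℙ³, K_d), K_d = Gr^F_{−2}DR(IC(R¹pr_{d*})) ONE bounded coherent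
complex (Hodge bundle pr_*ω, its dual, log/V-data along Δ), Saito vanishing + regularity growing
linearly in the net degree d, claim: for d ≫ 0 every section of ℍ⁰(K_d) is supported on a surface
(Beilinson monad / Bott); second lever dCM generic flags + relative hard Lefschetz for (η, pr^*h);
calibration: cubic fourfolds (Hassett C_8, Fermat), Fermat sextic, Weil-type abelian fourfolds;
known: CH₀-degenerate fourfolds (tree theorem), abelian fourfolds (Markman 2025 + Moonen–Zarhin),
Hodge-isometric K3×K3 (Buskin). #5 SummitGrantedFourfolds (SHARED with NoetherLefschetzOneUp,
staffed once there: registered ladder skeleton Cruxes/SummitGrantedFourfolds/Lines/birth.lean, stubs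
sixfoldsGrantedFourfolds / ladderFromEightfolds): granted HC(4;2,2), the middle degree of every even
dimension ≥ 6. ASIDES (banked context, NOT hypotheses of `closes`, kept because Theorems cite the
decls): VerticalSupportMiddle (≡ HodgeConjecture by theorem; its crux directory keeps the level ×
CH₀ analysis, STRATEGY-CENSUS.md, BC2-PROBES.md and the landed CH₀-degenerate theorem),
VerticalSupportBelowMiddle (derivable from the all-dimension middle statement + pencil facts,
Theorems/CurveNetMordellWeilVerticalSupportBelowMiddle.lean; as a stand-alone item it is HC below
the middle), VerticalSupportAboveMiddle (SIGNATURE DEFECT: ∀ surjective pr is too strong — X = C ×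
B' shows it implies HC(4), Theorems/CurveNetMordellWeilVerticalSupportAboveMiddleHardness.lean; the
intended Leray/Artin theorem needs a geometrically connected generic fibre), AlgebraicInNormalForm
and CubicFourfoldNormalForm (the card's Mordell–Weil normal form, easy half, and its p = 2
certificate — calibration records).
SUPPORT: DeligneDescent (closable NOW by the one-liner `deligneDescent_of_facts
Deligne1974_ker_restrictCompl_eq_iSup_range_complexGysin_holds
Voisin2025_hodgeClass_lift_complexGysin_holds`, cf.
Cruxes/VerticalSupportMiddle/Lines/p2_fourfold_heart_birth.lean `deligneDescent_holds`);
CurveNetExists (blow up the reduced base points of a general net in |O_X(d)|; σ_*σ^* = unit·id;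
construction files Theorems/CurveNetMordellWeilCurveNetExists{,Birational,LocalDegree,Transfer}.lean
in progress); GysinPreservesAlgebraic, ComplexOrientationExists, LefschetzOneOne, HodgeModels
(PROVED items); Assembly (the old nine-binder frame, PROVED, kept as record — the deciding theorem
is `closes`).
KILL CRITERIA. (a) A typed refutation of VerticalSupportFourfolds is a counterexample to HC for
fourfolds (not expected). Informative kills: (b) CALIBRATION — for the Fermat cubic/sextic fourfold
or a Hassett cubic with a plane, compute ℍ⁰(ℙ³, K_d) for small d symbolically (Jacobian-ring model
of pr_*ω and of the Kodaira–Spencer maps; ONE kit job): interior, non-vertical sections stable as d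
grows ⇒ the coherent presence engine is dead and the crux keeps only the generic HC(4) attacks
shared with MiddleDivisorSupportFourfold / FourfoldHodgeClassesConiveauOne / FourfoldsGrantedK3Nets
⇒ close `superseded` by the strongest of those; (c) SummitGrantedFourfolds refuted or retired on
NoetherLefschetzOneUp ⇒ this route loses its ladder as well (shared fate by design; the fallback is
the old codimension induction, whose middle step is HC itself — i.e. none); (d) a refutation of a
SUPPORT item through junk values of complexGysin for exotic ℂ-orientation families is bookkeeping
(restate with the inclusions rescaled), not a kill.
NOT DECOMPOSED YET. No typed ENGINE statement for the fourfold crux — it needs the two definition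
requests filed with this route (CurveNet: generic linear projection / blow-up with its discriminant;
SaitoGrFDeRham: Gr^F DR of the IC-extension of a geometric VHS on ℙ^m with Saito vanishing as named
facts); the CH₀ cut of the fourfold crux (theorem + heart, TWO-LAYER PLAN) is prepared but not
filed; no Tate/finite-field companion (Arapura's □_ℓ); no explicit d₀(X); the Mordell–Weil normal
form is recorded (asides) but deliberately not a target.
CHEAPEST FALSIFIER. The cruxes are implied by HC, so no special case refutes them cheaply; what is
cheap to kill is the ENGINE (kill criterion (b)): for the Fermat cubic fourfold (all 21 algebraic
(2,2)-classes known, Shioda) with its plane-cubic elliptic fibration Bl₃X → ℙ³, and for Hassett's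
C_8 (cubics containing a plane), compute symbolically — Jacobian-ring model of pr_*ω and of the
Kodaira–Spencer maps, one kit job, d = 1, 2, 3 — the space ℍ⁰(ℙ³, K_d), K_d = Gr^F_{−2}DR(IC
R¹pr_*), and test whether every section is supported on a surface T ⊂ ℙ³: a non-vertical (interior)
section that persists as d grows kills the coherent presence engine at its calibration point.
Second, pencil and paper: write the class of a plane P ⊂ X (Hassett C_8) as a Mordell–Weil section
class over V = π(P) plus fibre components and multiples of h², η·pr^*h — if even this explicit class
is not in the vertical span the normal form as drawn is wrong. Already run: the repaired deciding
theorem `closes` elaborates (lean check rc 0, standard axioms), so the items as typed assemble to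
HodgeConjecture.

Novelty: NEAREST PRIOR ART: Arapura2022 = arXiv:2103.05038 (READ pp. 2–5: for a FIXED fibred X, HC ⇐
surjectivity of the Leray cycle maps □^{p,i} onto Hodge cycles over U = complement of the
discriminant; fourfolds fibred in curves over threefolds need only □^{2,3}; engine = ABSENCE of
Hodge cycles; recovers ConteMurre1978); Zucker1977 / KerrPearlstein2011 (normal functions over
pencils of HYPERSURFACE sections, weight 2p−1 Jacobians); GreenGriffiths2007Singularities,
BrosnanFangNiePearlstein2009, DecataldoMigliorini2009, Schnell2011 (singularities / Néron models of
normal functions over ℙH⁰(O(d)), d → ∞ — hypersurface sections again); Deligne1980 §3 (the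
curve-fibration dévissage, for weights). NEAREST IN-TREE ROUTES (after the 2026-08-17 repair):
NoetherLefschetzOneUp (shares the ladder crux SummitGrantedFourfolds verbatim; its fourfold lever is
K3-type SURFACE nets over ℙ² with Noether–Lefschetz coefficients) and the coniveau-form fourfold
cruxes LinearSystemTorelli.MiddleDivisorSupportFourfold (stmt-2409) /
HolomorphicDefect.FourfoldHodgeClassesConiveauOne (stmt-3031) — all equivalent to HC(4) in content;
the routes differ by MECHANISM. DELTA: (1) universal CURVE NETS over ℙ³ and the VERTICAL-SUPPORT
formulation (∃ T ⊊ ℙ³ instead of a fixed U): the vertical classes are WEIGHT-ONE objects —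
Mordell–Weil (multi)section classes of Jacobian fibrations over surfaces — and one Deligne-descent
step reaches Lefschetz (1,1), the only cycle-producing input besides the crux (deciding theorem  [refs: 10.1016/j.aim.2009.07.012, 10.1112/plms/pds031, 2103.05038, doi:10.1016/j.aim.2009.07.012, doi:10.1112/plms/pds031, Arapura2022, ConteMurre1978, Zucker1977, KerrPearlstein2011, BrosnanFangNiePearlstein2009, DecataldoMigliorini2009, Schnell2011, Deligne1980, Saito1990, DecataldoMigliorini2010]

Barriers (technique_class: curve-nets,coniveau,normal-functions,dimension-ladder): BARRIERS (technique_class: curve-nets,coniveau,normal-functions,dimension-ladder).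
- Literature.Barriers.HodgeConjecture.Voisin2003_generalHypersurface_noIntegralClassInF: EVADED BY
CONSTRUCTION — the fibres are curves, the only variable Hodge structures are R¹ of curve families
(weight one: Jacobians are abelian varieties and Abel's theorem = Jacobi inversion holds); no
intermediate Jacobian J^p(H), p ≥ 2, of a hypersurface section is ever inverted: on the fourfold the
vertical part descends in ONE step to Lefschetz (1,1). The cost is moved to cohomological degree 3
on the base ℙ³ (lead crux VerticalSupportFourfolds), which the barrier does not address;
Green–Voisin torsion of normal functions concerns hypersurface families, not the Jacobian local
systems of curve nets. The LADDER crux SummitGrantedFourfolds does NOT evade it above dimension 4 —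
it is shared, conditional, and honestly open (middle degree of even dimensions ≥ 6); the bet of this
route is the fourfold lever, not the ladder.
- Literature.Barriers.HodgeConjecture.Grothendieck1969_generalHodgeConjecture_false: not engaged —
vertical support / base-coniveau ≥ 1 is asserted only for LEVEL-0 classes (rational (2,2)-classes),
for which every coniveau statement is implied by HC itself; no class-by-class level criterion for
types (p',q'), p' ≠ q', is used; DeligneDescent lifts Hodge classes along Gysin surjections by
semisimplicity, the mechanism of the AMENDED generalized Hodge conjecture.
- Literature.Barriers.HodgeC

History (route lifecycle, newest last):
- 2026-08-17T09:12:14Z · rev 4: dropped VerticalSupportBelowMiddle — route-repair: re-kind VerticalSupportBelowMiddle aside→support by drop+re-add (kind `aside` cannot be retriaged back: gate KeyError: 'aside'); banked text in in (planner-rbadge-HodgeConjecture-CurveNetMordell-9a58c73d-g3-0)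
- 2026-08-17T09:12:23Z · rev 4: dropped VerticalSupportAboveMiddle — route-repair: re-kind VerticalSupportAboveMiddle aside→support by drop+re-add (kind `aside` cannot be retriaged back: gate KeyError: 'aside'); banked text in in (planner-rbadge-HodgeConjecture-CurveNetMordell-9a58c73d-g3-0)
- 2026-08-17T09:13:31Z · rev 4: dropped CubicFourfoldNormalForm — route-repair: re-kind CubicFourfoldNormalForm aside→support by drop+re-add (kind `aside` cannot be retriaged back: gate KeyError: 'aside'); banked text in infor (planner-rbadge-HodgeConjecture-CurveNetMordell-9a58c73d-g3-0)
- 2026-08-17T11:28:54Z · rev 7: dropped stmt-HodgeConjecture-17958 — route-repair g7 (badge): un-wedge step 1/5 — drop+re-add CubicFourfoldNormalForm as support (same decl name, statement, informal; kind aside wedges the gate: Ke (planner-rbadge-HodgeConjecture-CurveNetMordell-9a58c73d-g7-0)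
- 2026-08-17T11:29:30Z · rev 7: dropped stmt-HodgeConjecture-17949 — route-repair g7 (badge): un-wedge — drop+re-add AlgebraicInNormalForm as support (same decl name/statement/informal; Theorems reference the decl); kind aside we (planner-rbadge-HodgeConjecture-CurveNetMordell-9a58c73d-g7-0)
- 2026-08-17T11:29:31Z · rev 7: dropped stmt-HodgeConjecture-17956 — route-repair g7 (badge): un-wedge — drop+re-add VerticalSupportBelowMiddle as support (same decl name/statement/informal; Theorems reference the decl); kind asi (planner-rbadge-HodgeConjecture-CurveNetMordell-9a58c73d-g7-0)
- 2026-08-17T11:29:39Z · rev 7: dropped stmt-HodgeConjecture-17957 — route-repair g7 (badge): un-wedge — drop+re-add VerticalSupportAboveMiddle as support (same decl name/statement/informal; Theorems reference the decl); kind asi (planner-rbadge-HodgeConjecture-CurveNetMordell-9a58c73d-g7-0)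
- 2026-08-17T11:29:41Z · rev 7: dropped stmt-HodgeConjecture-17954 — route-repair g7 (badge): un-wedge — drop+re-add VerticalSupportMiddle as support (same decl name/statement/informal; Theorems reference the decl); kind aside we (planner-rbadge-HodgeConjecture-CurveNetMordell-9a58c73d-g7-0)

sub-problem: HodgeConjecture · status: open · opened planner-plancard-HodgeConjecture-HodgeConject-ab717566-0 2026-08-15T11:08:21Z · rev 9 · ledger route-HodgeConjecture-CurveNetMordellWeil
GENERATED by the gate from the ledger (D-0016/17). Provers cite these decls: `theorem foo : Summit.HodgeConjecture.HodgeConjecture.Theses.CurveNetMordellWeil.<Decl> := …` in Summits/HodgeConjecture/HodgeConjecture/Theorems/<Name>.lean.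
-/

namespace Summit.HodgeConjecture.HodgeConjecture.Theses.CurveNetMordellWeil

open scoped BigOperators Topology Manifold Classical MeasureTheory ProbabilityTheory Matrix InnerProductSpace ComplexConjugate ContinuousMap
open Filter Set Function TopologicalSpace MeasureTheory

attribute [summit_statement] _root_.HodgeConjecture

/-- item stmt-HodgeConjecture-2784 · crux · rank 4 · open · by planner
why it might fail: ⇔ HC(2,2) for ALL smooth projective fourfolds; CH₀-degenerate ones are DONE (tree theorem), open for p_g > 0 (K3×K3 with real multiplication, CY/HK, general type). Engine risk: ℍ⁰(K_d) may keep interior sections for every d; h^{3,1} ≠ 0 forces primitive classes to be Mordell–Weil over surfaces.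
sources: ConteMurre1978, Zucker1977, Markman2025SecantWeil, Arapura2022, KerrPearlstein2011, VoisinHodgeII2003
[crux #4] THE FOURFOLD CASE (n = 4, q = 2, base ℙ³) — calibration ground and first target of the
engine. X smooth projective fourfold, pr : X → ℙ³ surjective: every rational (2,2)-class is
algebraic modulo rational (2,2)-classes supported over a proper closed T ⊂ ℙ³ (a surface). ONE
descent step: a class supported on pr⁻¹(T) is a Gysin image of a (1,1)-class from a resolution of
the threefold pr⁻¹(T) → T, i.e. (Zucker / M. Saito, admissible normal functions) a MORDELL–WEIL
class of the Jacobian fibration over the surface T plus fibre components. Case n = 4 of #2 (Sketch: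
fourfolds_of_middle); U-free form of Arapura Cor. 1.4. CALIBRATION (before any Beilinson-monad
work): (i) cubic fourfolds — projection from a general line gives the plane-cubic ELLIPTIC fibration
Bl₃X → ℙ³; a plane P ⊂ X is a SECTION over the plane π(P) ⊂ ℙ³; tabulate the Mordell–Weil lattices
over planes/quadrics carrying H^{2,2}∩H⁴(X,ℚ) for the Fermat cubic and Hassett's C_8; (ii) Fermat
sextic; (iii) Weil-type abelian fourfolds; (iv) kit job: Jacobian-ring model of K_d on ℙ³ for the
cubic, small d — interior summands in ℍ⁰? Known cases: uniruled fourfolds (ConteMurre1978), cubics,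
genus-2 families (Arapura2022). -/
@[route_item "route-HodgeConjecture-CurveNetMordellWeil", crux]
def VerticalSupportFourfolds : Prop :=
  ∀ ⦃X : Literature.AlgebraicGeometry.Motives.SchemeOver ℂ⦄ (pr : X ⟶ Literature.AlgebraicGeometry.Motives.projectiveSpace 3 ℂ), Literature.AlgebraicGeometry.Motives.IsSmoothProjective 4 X → Function.Surjective pr.left.base → Submodule.span ℂ {c : Literature.AlgebraicGeometry.HodgeTheory.complexBetti X (2 * 2) | Literature.AlgebraicGeometry.HodgeTheory.IsRationalClass c ∧ Literature.AlgebraicGeometry.HodgeTheory.IsOfHodgeType 4 X (2 * 2) 2 2 c} ≤ Literature.AlgebraicGeometry.HodgeTheory.algebraicClasses X 2 ⊔ Submodule.span ℂ {c : Literature.AlgebraicGeometry.HodgeTheory.complexBetti X (2 * 2) | Literature.AlgebraicGeometry.HodgeTheory.IsRationalClass c ∧ Literature.AlgebraicGeometry.HodgeTheory.IsOfHodgeType 4 X (2 * 2) 2 2 c ∧ ∃ T : Set (Literature.AlgebraicGeometry.Motives.projectiveSpace 3 ℂ).left, IsClosed T ∧ T ≠ Set.univ ∧ Literature.AlgebraicGeometry.HodgeTheory.complexBetti.restrictCompl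 X (pr.left.base ⁻¹' T) (2 * 2) c = 0}

/-- item stmt-HodgeConjecture-14600 · crux · rank 5 · open · by planner
why it might fail: Granted HC(4,2) it is HC in the middle degree of every even dim ≥ 6 (BFNP Lem. 48; nothing descends from dim 4 upward): general Weil-type abelian 2n-folds, n ≥ 3, carry non-divisorial Hodge classes (vanGeemen1994 Thm 4.11), algebraic only for disc −1 sixfolds (arXiv:2502.03415).
sources: Deligne2000, BrosnanFangNiePearlstein2009, vanGeemen1994HodgeAV, Markman2025SecantWeil, arXiv:2502.03415, KerrPearlstein2011
[crux] THE SUMMIT, GRANTED THE FOURFOLD MIDDLE DEGREE (rank 4; conditional complement beyond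
dimension 4 — D-0027 §2.1 route-repair 2026-08-16: replaces SummitBeyondFourfolds
stmt-HodgeConjecture-14417, whose unconditional form 'every rational middle-degree Hodge class in
every even dimension ≥ 6 is algebraic' implies the whole summit by itself through X ↦ X × ℙ²
(refuter crux-attack, RESTATES-THE-TARGET), and absorbs the print theorems MiddleReduction /
HodgeModels / LefschetzOneOne, which stay as support items = the foreseen stubs of this crux).
Statement: (every rational (2,2)-class on every smooth projective fourfold is algebraic) → for every
n and every smooth projective complex n-fold X, a Hodge model of X exists and every rational
(p,p)-class on X is algebraic — i.e. HodgeConjectureFor n X for all n, X, spelled out. How the line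
reaches it: HodgeModels (conjunct 1: GAGA + de Rham + Hodge decomposition); MiddleReduction (BFNP
Lemma 48: products with projective spaces below the middle, general slices of X × (ℙ¹)^r above it,
reduce everything to the middle degree of even-dimensional varieties); m = 0 trivial
(algebraicClasses_zero), m = 1 Lefschetz (1,1) (LefschetzOneOne), m = -/
@[route_item "route-HodgeConjecture-CurveNetMordellWeil", crux]
def SummitGrantedFourfolds : Prop :=
  (∀ ⦃X : Literature.AlgebraicGeometry.Motives.SchemeOver ℂ⦄, Literature.AlgebraicGeometry.Motives.IsSmoothProjective 4 X → ∀ c : Literature.AlgebraicGeometry.HodgeTheory.complexBetti X (2 * 2), Literature.AlgebraicGeometry.HodgeTheory.IsRationalClass c → Literature.AlgebraicGeometry.HodgeTheory.IsOfHodgeType 4 X (2 * 2) 2 2 c → c ∈ Literature.AlgebraicGeometry.HodgeTheory.algebraicClasses X 2) → ∀ ⦃n : ℕ⦄ ⦃X : Literature.AlgebraicGeometry.Motives.SchemeOver ℂ⦄, Literature.AlgebraicGeometry.Motives.IsSmoothProjective n X → Nonempty (Literature.AlgebraicGeometry.HodgeTheory.HodgeModel n X) ∧ ∀ (p : ℕ)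 (c : Literature.AlgebraicGeometry.HodgeTheory.complexBetti X (2 * p)), Literature.AlgebraicGeometry.HodgeTheory.IsRationalClass c → Literature.AlgebraicGeometry.HodgeTheory.IsOfHodgeType n X (2 * p) p p c → c ∈ Literature.AlgebraicGeometry.HodgeTheory.algebraicClasses X p

/-- item stmt-HodgeConjecture-18093 · support · rank 9 · closed · proved by Summit.HodgeConjecture.HodgeConjecture.Theorems.curveNetMordellWeil_cubicFourfoldNormalForm_proof @ a20a8fb54fbb (prover) · by planner
sources: Zucker1977, ConteMurre1978
[support / calibration certificate, p = 2] THE MORDELL–WEIL NORMAL FORM ON CUBIC FOURFOLDS: for X ⊂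
ℙ⁵ a smooth cubic hypersurface (IsSmoothHypersurface 4 3 X) every rational (2,2)-class is a
ℂ-combination of Gysin images of divisor classes from smooth projective threefolds W → X. TRUE:
Zucker 1977 (HC for cubic fourfolds via normal functions on the pencil of cubic threefolds, J² =
J²_alg by Clemens–Griffiths; also Conte–Murre for the uniruled case) + AlgebraicInNormalForm. Its
role here is the typed certificate of the CALIBRATION in crux #4: the intended W are the elliptic
threefolds X̃_V = π⁻¹(V) of the plane-cubic fibration Bl₃X → ℙ³ (projection from a general line)
over surfaces V ⊂ ℙ³, and the intended δ are Mordell–Weil (section/multisection) classes — e.g. a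
plane P ⊂ X is a section over the plane V = π(P). A prover closing this item from Zucker1977 as a
named fact should ALSO record (as evidence/notes) which V and which MW classes realise the 20
primitive algebraic classes of the Fermat cubic and the class of a plane for Hassett's divisor C_8 —
that table is the data from which the engine for #2 is to be guessed. [BANKED 2026-08-17:
calibration certificate, not a hypothesis -/
@[route_item "route-HodgeConjecture-CurveNetMordellWeil"]
def CubicFourfoldNormalForm : Prop :=
  ∀ (μ : Literature.AlgebraicGeometry.HodgeTheory.OrientationFamily), μ.HasPoincareDuality → ∀ ⦃X : Literature.AlgebraicGeometry.Motives.SchemeOver ℂ⦄ (hX : Literature.AlgebraicGeometry.Motives.IsSmoothProjective (2 * 2) X), Literature.AlgebraicGeometry.Motives.IsSmoothHypersurface (2 * 2) 3 X → Submodule.span ℂ {c : Literature.AlgebraicGeometry.HodgeTheory.complexBetti X (2 * 2) | Literature.AlgebraicGeometry.HodgeTheory.IsRationalClass c ∧ Literature.AlgebraicGeometry.HodgeTheory.IsOfHodgeType (2 * 2) X (2 * 2) 2 2 c} ≤ ⨆ (W : Literature.AlgebraicGeometry.Motives.SchemeOver ℂ) (hW : Literature.AlgebraicGeometry.Motives.IsSmoothProjective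 (2 + 1) W) (f : W ⟶ X), (Literature.AlgebraicGeometry.HodgeTheory.algebraicClasses W 1).map (Literature.AlgebraicGeometry.HodgeTheory.complexGysin μ hW hX f (show 2 * 1 + 2 * (2 * 2) = 2 * 2 + 2 * (2 + 1) by omega))

/-- item stmt-HodgeConjecture-18097 · support · rank 9 · closed · proved by Summit.HodgeConjecture.HodgeConjecture.Theorems.curveNetMordellWeil_algebraicInNormalForm_proof @ 43a83f1dd72a (prover) · by planner
sources: Fulton1998, Hironaka1964, VoisinHodgeII2003
[support] THE EASY HALF OF THE CARD'S 'HC(p) ⇔ MORDELL–WEIL NORMAL FORM': on a smooth projective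
2p-fold X (p ≥ 1) every ALGEBRAIC class of codimension p is a ℂ-combination of Gysin images f_*(δ)
of divisor classes δ ∈ N¹H²(W) on smooth projective (p+1)-folds f : W → X. Proof: for an irreducible
p-dimensional Z ⊂ X choose an irreducible (p+1)-dimensional Y with Z ⊂ Y ⊂ X (intersect X with p−1
general hypersurfaces of large degree containing Z; Bertini off Z), a resolution W → Y (Hironaka)
and a component D of the preimage of Z dominating Z, of degree e ≥ 1 over Z; then f_*[D] = e·[Z]
(cycle class commutes with proper push-forward, Fulton 19.1 / Voisin II Prop. 9.21) and [D] ∈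
N¹H²(W). For the curve net this is the statement that cone/ruled (p+1)-folds through Z carry Z as a
divisor; together with the hard half (the route's induction) it gives the card's equivalence
'HC(X^{2p}) ⇔ every rational (p,p)-class is a sum of Gysin images of Mordell–Weil/divisor classes
from (p+1)-folds fibred in curves over p-folds of ℙ^{2p−1}'. p = 1: W = X, f = id. [BANKED
2026-08-17: calibration record, not a hypothesis of `closes`.] -/
@[route_item "route-HodgeConjecture-CurveNetMordellWeil", crux]
def AlgebraicInNormalForm : Prop :=
  ∀ (μ : Literature.AlgebraicGeometry.HodgeTheory.OrientationFamily), μ.HasPoincareDuality → ∀ ⦃p : ℕ⦄ ⦃X : Literature.AlgebraicGeometry.Motives.SchemeOver ℂ⦄ (hX : Literature.AlgebraicGeometry.Motives.IsSmoothProjective (2 * p) X), 1 ≤ p → Literature.AlgebraicGeometry.HodgeTheory.algebraicClasses X p ≤ ⨆ (W : Literature.AlgebraicGeometry.Motives.SchemeOver ℂ) (hW : Literature.AlgebraicGeometry.Motives.IsSmoothProjective (p + 1) W) (f : W ⟶ X), (Literature.AlgebraicGeometry.HodgeTheory.algebraicClasses W 1).map (Literature.AlgebraicGeometry.HodgeTheory.complexGysin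 μ hW hX f (show 2 * 1 + 2 * (2 * p) = 2 * p + 2 * (p + 1) by omega))

/-- item stmt-HodgeConjecture-18098 · support · rank 9 · open · by planner
why it might fail: BANKED: HC-true; stand-alone it contains HC in codim q < n/2 (open from q = 2), derivable from the middle statement (≡ HC); not a hypothesis of `closes`. Do not staff.
[support — BANKED, not a hypothesis of `closes`] VERTICAL SUPPORT BELOW THE MIDDLE DEGREE (2 ≤ q, 2q
< n): every rational (q,q)-class on a curve-netted n-fold is algebraic modulo classes supported on
pr⁻¹(T), T ⊊ ℙ^{n−1}. Not load-bearing after the 2026-08-17 re-glue (closes no longer inducts on the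
codimension); derivable from the middle statement (≡ HC) + three pencil facts
(Theorems/CurveNetMordellWeilVerticalSupportBelowMiddle.lean, VerticalSupportBelowMiddle_of);
stand-alone it is HC below the middle degree (open from (2,2)-classes on 5-folds) with no engine of
its own. DO NOT STAFF. -/
@[route_item "route-HodgeConjecture-CurveNetMordellWeil"]
def VerticalSupportBelowMiddle : Prop :=
  ∀ ⦃n q m : ℕ⦄ ⦃X : Literature.AlgebraicGeometry.Motives.SchemeOver ℂ⦄ (pr : X ⟶ Literature.AlgebraicGeometry.Motives.projectiveSpace m ℂ), Literature.AlgebraicGeometry.Motives.IsSmoothProjective n X → 2 ≤ q → 2 * q < n → m + 1 = n → Function.Surjective pr.left.base → Submodule.span ℂ {c : Literature.AlgebraicGeometry.HodgeTheory.complexBetti X (2 * q) | Literature.AlgebraicGeometry.HodgeTheory.IsRationalClass c ∧ Literature.AlgebraicGeometry.HodgeTheory.IsOfHodgeType n X (2 * q) q q c} ≤ Literature.AlgebraicGeometry.HodgeTheory.algebraicClasses X q ⊔ Submodule.span ℂ {c : Literature.AlgebraicGeometry.HodgeTheory.complexBetti X (2 * q) | Literature.AlgebraicGeometry.HodgeTheory.IsRationalClass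 c ∧ Literature.AlgebraicGeometry.HodgeTheory.IsOfHodgeType n X (2 * q) q q c ∧ ∃ T : Set (Literature.AlgebraicGeometry.Motives.projectiveSpace m ℂ).left, IsClosed T ∧ T ≠ Set.univ ∧ Literature.AlgebraicGeometry.HodgeTheory.complexBetti.restrictCompl X (pr.left.base ⁻¹' T) (2 * q) c = 0}

/-- item stmt-HodgeConjecture-18099 · support · rank 9 · open · by planner
why it might fail: BANKED: SIGNATURE DEFECT — as typed it implies HC for every fourfold (X = C × B'); not a hypothesis of `closes` any more. Do not staff.
[support — BANKED, not a hypothesis of `closes`] ABOVE THE MIDDLE DEGREE (2 ≤ q, n < 2q). SIGNATURE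
DEFECT (retriage 2026-08-15; Theorems/CurveNetMordellWeilVerticalSupportAboveMiddleHardness.lean): ∀
surjective pr is too strong — X = C × B' → B' → ℙ⁴ (B' any fourfold) makes it imply HC for every
fourfold; the intended hypothesis-free Leray/Artin theorem needs a geometrically connected generic
fibre (a section). Not needed by the re-glued `closes` (hard Lefschetz above the middle is a tree
theorem inside the ladder crux SummitGrantedFourfolds). DO NOT STAFF; a tenure planner may restate
it with a section hypothesis if a line ever needs it. -/
@[route_item "route-HodgeConjecture-CurveNetMordellWeil"]
def VerticalSupportAboveMiddle : Prop :=
  ∀ ⦃n q m : ℕ⦄ ⦃X : Literature.AlgebraicGeometry.Motives.SchemeOver ℂ⦄ (pr : X ⟶ Literature.AlgebraicGeometry.Motives.projectiveSpace m ℂ), Literature.AlgebraicGeometry.Motives.IsSmoothProjective n X → 2 ≤ q → n < 2 * q → m + 1 = n → Function.Surjective pr.left.base → Submodule.span ℂ {c : Literature.AlgebraicGeometry.HodgeTheory.complexBetti X (2 * q) | Literature.AlgebraicGeometry.HodgeTheory.IsRationalClass c ∧ Literature.AlgebraicGeometry.HodgeTheory.IsOfHodgeType n X (2 * q) q q c}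 ≤ Literature.AlgebraicGeometry.HodgeTheory.algebraicClasses X q ⊔ Submodule.span ℂ {c : Literature.AlgebraicGeometry.HodgeTheory.complexBetti X (2 * q) | Literature.AlgebraicGeometry.HodgeTheory.IsRationalClass c ∧ Literature.AlgebraicGeometry.HodgeTheory.IsOfHodgeType n X (2 * q) q q c ∧ ∃ T : Set (Literature.AlgebraicGeometry.Motives.projectiveSpace m ℂ).left, IsClosed T ∧ T ≠ Set.univ ∧ Literature.AlgebraicGeometry.HodgeTheory.complexBetti.restrictCompl X (pr.left.base ⁻¹' T) (2 * q) c = 0}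

/-- item stmt-HodgeConjecture-18100 · support · rank 9 · open · by planner
why it might fail: BANKED: as typed it is EQUIVALENT to the Hodge conjecture (Theorems.verticalSupportMiddle_iff_hodgeConjecture). Not a hypothesis of `closes`; do not staff.
[support — BANKED, not a hypothesis of `closes`] As typed this statement is EQUIVALENT to the Hodge
conjecture (tree theorem Theorems.verticalSupportMiddle_iff_hodgeConjecture,
CurveNetMordellWeilVerticalSupportMiddleIffHodge.lean, p140425; skeleton.hides-summit 2026-08-17:
its one registered line regime-split-middle-step is complete except a heart equal to HC). DO NOT
STAFF. The decl is kept because ~30 Theorems cite it; its Cruxes/VerticalSupportMiddle/ directory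
keeps the level × CH₀ analysis (STRATEGY-CENSUS.md, SPLIT-PACKAGE.md, BC2-PROBES.md) and the landed
CH₀-degenerate fourfold theorem (hodgeFourfoldsChowDegenerate_holds). Original text: VERTICAL
SUPPORT IN THE MIDDLE DEGREE — X smooth projective of dimension n = 2q ≥ 4, pr : X → ℙ^{2q−1}
surjective: every rational (q,q)-class is algebraic modulo rational (q,q)-classes supported on
pr⁻¹(T), T ⊊ ℙ^{2q−1} closed. -/
@[route_item "route-HodgeConjecture-CurveNetMordellWeil"]
def VerticalSupportMiddle : Prop :=
  ∀ ⦃q m : ℕ⦄ ⦃X : Literature.AlgebraicGeometry.Motives.SchemeOver ℂ⦄ (pr : X ⟶ Literature.AlgebraicGeometry.Motives.projectiveSpace m ℂ), Literature.AlgebraicGeometry.Motives.IsSmoothProjective (2 * q) X → 2 ≤ q → m + 1 = 2 * q → Function.Surjective pr.left.base → Submodule.span ℂ {c : Literature.AlgebraicGeometry.HodgeTheory.complexBetti X (2 * q) | Literature.AlgebraicGeometry.HodgeTheory.IsRationalClass c ∧ Literature.AlgebraicGeometry.HodgeTheory.IsOfHodgeType (2 * q) X (2 * q) q q c} ≤ Literature.AlgebraicGeometry.HodgeTheory.algebraicClasses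 X q ⊔ Submodule.span ℂ {c : Literature.AlgebraicGeometry.HodgeTheory.complexBetti X (2 * q) | Literature.AlgebraicGeometry.HodgeTheory.IsRationalClass c ∧ Literature.AlgebraicGeometry.HodgeTheory.IsOfHodgeType (2 * q) X (2 * q) q q c ∧ ∃ T : Set (Literature.AlgebraicGeometry.Motives.projectiveSpace m ℂ).left, IsClosed T ∧ T ≠ Set.univ ∧ Literature.AlgebraicGeometry.HodgeTheory.complexBetti.restrictCompl X (pr.left.base ⁻¹' T) (2 * q) c = 0}

/-- item stmt-HodgeConjecture-2786 · support · rank 9 · closed · proved by Summit.HodgeConjecture.HodgeConjecture.Theorems.curveNetMordellWeil_deligneDescent_proof @ b7f51aef28a3 (prover) · by planner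
sources: DeligneHodgeIII1974, Jannsen1990MixedMotives, Hironaka1964, VoisinHodgeII2003
[support] DELIGNE DESCENT (Hodge III, Cor. 8.2.8 + semisimplicity of polarisable Hodge structures;
Jannsen's homological Hodge conjecture formalism). X smooth projective of dimension n, Y ⊊ X
Zariski-closed, c ∈ H^{2q}(X(ℂ);ℂ) rational of type (q,q) with c|_{(X∖Y)(ℂ)} = 0. Then c lies in the
ℂ-span of Gysin images g_*(β), g : W → X from smooth projective W of dimension m = n − e, 1 ≤ e ≤ q
(intended: resolutions of the components of Y, e = codimension), β ∈ H^{2(q−e)}(W) rational of type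
(q−e, q−e). Printed proof: ker(H^{2q}(X,ℚ) → H^{2q}(X∖Y,ℚ)) = Σ_j Im(Gysin: H^{2q−2e_j}(Ỹ_j,ℚ)(−e_j)
→ H^{2q}(X,ℚ)) for resolutions Ỹ_j → Y_j of the components (Hodge III 8.2.8: H^{2q}_Y(X) has weights
≥ 2q, its weight-2q part is the image of the resolutions); Gysin maps are morphisms of polarisable
ℚ-HS, so the Hodge class c lifts to Hodge classes β_j (semisimplicity); ℂ-coefficients by universal
coefficients. Stated with the REAL Gysin maps complexGysin μ (∀ orientation families μ with Poincaré
duality; exotic ℂ-orientations rescale Gysin maps by units, spans are invariant). Facts to vendor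
first (cite item filed): Hodge III 8.2.8 in support form; Hodge-class lifting for polarisable HS;
Hironaka. -/
@[route_item "route-HodgeConjecture-CurveNetMordellWeil", crux]
def DeligneDescent : Prop :=
  ∀ (μ : Literature.AlgebraicGeometry.HodgeTheory.OrientationFamily), μ.HasPoincareDuality → ∀ ⦃n q : ℕ⦄ ⦃X : Literature.AlgebraicGeometry.Motives.SchemeOver ℂ⦄ (hX : Literature.AlgebraicGeometry.Motives.IsSmoothProjective n X) (Y : Set X.left), IsClosed Y → Y ≠ Set.univ → ∀ c : Literature.AlgebraicGeometry.HodgeTheory.complexBetti X (2 * q), Literature.AlgebraicGeometry.HodgeTheory.IsRationalClass c → Literature.AlgebraicGeometry.HodgeTheory.IsOfHodgeType n X (2 * q) q q c → Literature.AlgebraicGeometry.HodgeTheory.complexBetti.restrictCompl X Y (2 * q) c = 0 → c ∈ ⨆ (d : ℕ) (e : ℕ) (_ : d + e = q) (_ : 1 ≤ e) (W : Literature.AlgebraicGeometry.Motives.SchemeOver ℂ) (m : ℕ) (hm : m + e = n) (hW : Literature.AlgebraicGeometry.Motives.IsSmoothProjective m W) (g : W ⟶ X), (Submodule.span ℂ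 {b : Literature.AlgebraicGeometry.HodgeTheory.complexBetti W (2 * d) | Literature.AlgebraicGeometry.HodgeTheory.IsRationalClass b ∧ Literature.AlgebraicGeometry.HodgeTheory.IsOfHodgeType m W (2 * d) d d b}).map (Literature.AlgebraicGeometry.HodgeTheory.complexGysin μ hW hX g (show 2 * d + 2 * n = 2 * q + 2 * m by omega))

/-- item stmt-HodgeConjecture-2787 · support · rank 9 · closed · proved by Summit.HodgeConjecture.HodgeConjecture.Theorems.curveNetMordellWeil_gysinPreservesAlgebraic_proof @ d4edf071e019 (prover) · by planner
sources: FultonYoungTableaux1997, Fulton1998, VoisinHodgeII2003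
[support] GYSIN IMAGES OF ALGEBRAIC CLASSES ARE ALGEBRAIC, with the degree/codimension bookkeeping
the Assembly uses: g : W → X a morphism of smooth projective varieties, dim W = m, dim X = n = m +
e; then g_*(N^d H^{2d}(W(ℂ);ℂ)) ⊆ N^{d+e} H^{2d+2e}(X(ℂ);ℂ). Proof: a generator of algebraicClasses
W d vanishes on (W∖S)(ℂ) for a Zariski-closed S all of whose points have codimension ≥ d; by the
Borel–Moore base-change property of Gysin maps (the tree's named fact
AlgebraicTopology.SingularHomology.gysinMap_restrictCompl_eq_zero, Fulton Young Tableaux App. B Ex.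
5 — the support form already used for GysinFormalism.gysin_restrictCompl_eq_zero) its image vanishes
on (X∖g(S))(ℂ); g is proper so g(S) is closed, and dim g(S) ≤ dim S ≤ m − d, so every point of g(S)
has codimension ≥ n − (m − d) = d + e in X (dimension theory of finite-type ℂ-schemes: coheight = n
− dim of closure for X irreducible; images do not increase dimension). Includes e = 0 (birational σ
: X' → X of the curve net: σ_* preserves algebraic classes). -/
@[route_item "route-HodgeConjecture-CurveNetMordellWeil", crux]
def GysinPreservesAlgebraic : Prop :=
  ∀ (μ : Literature.AlgebraicGeometry.HodgeTheory.OrientationFamily), μ.HasPoincareDuality → ∀ ⦃m n d e : ℕ⦄ ⦃W X : Literature.AlgebraicGeometry.Motives.SchemeOver ℂ⦄ (hW : Literature.AlgebraicGeometry.Motives.IsSmoothProjective m W) (hX : Literature.AlgebraicGeometry.Motives.IsSmoothProjective n X) (g : W ⟶ X) (hm : m + e = n), (Literature.AlgebraicGeometry.HodgeTheory.algebraicClasses W d).map (Literature.AlgebraicGeometry.HodgeTheory.complexGysin μ hW hX g (show 2 * d + 2 * n = 2 * (d + e) + 2 * m by omega)) ≤ Literature.AlgebraicGeometry.HodgeTheory.algebraicClasses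 X (d + e)

/-- item stmt-HodgeConjecture-2788 · support · rank 9 · closed · proved by Summit.HodgeConjecture.HodgeConjecture.Theorems.curveNetMordellWeil_curveNetExists_proof @ e7006a42d1af (prover) · by planner
sources: VoisinHodgeII2003, Hartshorne1977
[support / construction] GENERIC CURVE NETS EXIST. For X smooth projective of dimension n ≥ 2
(embedded by O_X(d), any d ≥ 1) and m + 1 = n there are: a smooth projective n-fold X', a morphism σ
: X' → X and a SURJECTIVE morphism pr : X' → ℙ^m such that for every q the span of rational
(q,q)-classes of X lies in σ_* of the span of rational (q,q)-classes of X'. Construction: n general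
sections s_0,…,s_m of O_X(d) (= projection from a general centre Λ of codimension n after the d-uple
embedding); their common zeros F = X ∩ Λ are d^n·deg X REDUCED points where the s_i generate the
maximal ideal (Bertini), so X' := Bl_F X is smooth, geometrically irreducible, projective, and (s_0
: … : s_m) extends to a morphism pr : X' → ℙ^m with fibres the curve sections X ∩ ⟨Λ,b⟩ — never
empty (projective dimension theorem), so pr is onto; the exceptional divisors E_i ≅ ℙ^m are
sections. Cohomology: σ^*c is rational of type (q,q) when c is (pull-back functoriality), and
σ_*σ^*c = (σ_*1)·c with σ_*1 a NONZERO scalar (σ is an iso over X ∖ F; for exotic ℂ-orientations the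
scalar is a unit — all the span statement needs). Mathlib: build Bl_F X (F finite reduced) or the
incidence variety in X × ℙ^m. -/
@[route_item "route-HodgeConjecture-CurveNetMordellWeil", crux]
def CurveNetExists : Prop :=
  ∀ (μ : Literature.AlgebraicGeometry.HodgeTheory.OrientationFamily), μ.HasPoincareDuality → ∀ ⦃n m : ℕ⦄ ⦃X : Literature.AlgebraicGeometry.Motives.SchemeOver ℂ⦄ (hX : Literature.AlgebraicGeometry.Motives.IsSmoothProjective n X), 2 ≤ n → m + 1 = n → ∃ (X' : Literature.AlgebraicGeometry.Motives.SchemeOver ℂ) (hX' : Literature.AlgebraicGeometry.Motives.IsSmoothProjective n X') (σ : X' ⟶ X) (pr : X' ⟶ Literature.AlgebraicGeometry.Motives.projectiveSpace m ℂ), Function.Surjective pr.left.base ∧ ∀ q : ℕ, Submodule.span ℂ {c : Literature.AlgebraicGeometry.HodgeTheory.complexBetti X (2 * q) | Literature.AlgebraicGeometry.HodgeTheory.IsRationalClass c ∧ Literature.AlgebraicGeometry.HodgeTheory.IsOfHodgeType n X (2 * q) q q c} ≤ (Submodule.span ℂ {c : Literature.AlgebraicGeometry.HodgeTheory.complexBetti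 X' (2 * q) | Literature.AlgebraicGeometry.HodgeTheory.IsRationalClass c ∧ Literature.AlgebraicGeometry.HodgeTheory.IsOfHodgeType n X' (2 * q) q q c}).map (Literature.AlgebraicGeometry.HodgeTheory.complexGysin μ hX' hX σ rfl)

/-- item stmt-HodgeConjecture-2789 · support · rank 9 · closed · proved by Summit.HodgeConjecture.HodgeConjecture.Theorems.complexOrientationExists_proof @ 8cbda2dcc9c9 (prover) · by planner
sources: HatcherAT2002, FultonYoungTableaux1997
[support] COMPLEX ORIENTATIONS EXIST AND SATISFY POINCARÉ DUALITY: there is an OrientationFamily μ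
(a ℂ-orientation of the closed 2n-manifold X(ℂ) for every smooth projective X of dimension n) with
μ.HasPoincareDuality. Intended witness: the complex orientation (holomorphic charts of the GAGA
atlas Motives.ComplexPoints.chartedSpace are orientation-preserving, so the local classes glue:
HomologicalOrientation.ofLocalFamily), and Poincaré duality for closed oriented manifolds (Hatcher
Thm. 3.30 = the tree's named fact bijective_poincareDualityMap;
OrientationFamily.hasPoincareDuality_of turns it into HasPoincareDuality). Every Gysin statement of
the route quantifies over such μ; this item discharges the quantifier in the Assembly. -/
@[route_item "route-HodgeConjecture-CurveNetMordellWeil", crux]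
def ComplexOrientationExists : Prop :=
  ∃ μ : Literature.AlgebraicGeometry.HodgeTheory.OrientationFamily, μ.HasPoincareDuality

/-- item stmt-HodgeConjecture-3050 · support · rank 9 · closed · proved by Summit.HodgeConjecture.HodgeConjecture.Theorems.curveNetMordellWeil_hodgeModels_proof @ 614fa71ac06a (prover) · by planner
[support] Every smooth projective complex variety has a Hodge model (analytification + natural de
Rham comparison + Hodge decomposition): literally ∀ n X,
Literature.AlgebraicGeometry.HodgeTheory.nonempty_hodgeModel n X (named fact,
HodgeModelExistence.lean; conditional assembly nonempty_hodgeModel_of in HodgeModelExistenceProofs).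
Supplies the anti-vacuity conjunct of HodgeConjectureFor in the Assembly. Sources: SerreGAGA1956,
VoisinHodgeI2002 Thm 6.18. -/
@[route_item "route-HodgeConjecture-CurveNetMordellWeil", crux]
def HodgeModels : Prop :=
  ∀ ⦃n : ℕ⦄ ⦃X : Literature.AlgebraicGeometry.Motives.SchemeOver ℂ⦄, Literature.AlgebraicGeometry.Motives.IsSmoothProjective n X → Nonempty (Literature.AlgebraicGeometry.HodgeTheory.HodgeModel n X)

/-- item stmt-HodgeConjecture-8544 · support · rank 9 · closed · proved by Summit.HodgeConjecture.HodgeConjecture.Theorems.lefschetzOneOne_proof @ 44a5d6d9a7d8 (prover) · by planner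
[support] LEFSCHETZ'S THEOREM ON (1,1)-CLASSES, rational form = the Literature NAMED FACT, filed as
an item of this route by the cone route-repair (2026-08-15) to mark it as GENUINELY NEEDED tier-0
debt. needs-fact: Literature.AlgebraicGeometry.HodgeTheory.lefschetzOneOne_rational (file
Literature/AlgebraicGeometry/HodgeTheory/LefschetzOneOne.lean; Voisin I Thm. 11.30 + Lelong Thm.
11.33 + GAGA Cor. 11.34, §11.3.3; exponential sequence). Statement VERBATIM that fact (complexBetti
is an abbrev of singularCohomology ℂ ℂ (ComplexPoints X)): for X smooth projective of dimension n
over ℂ, every rational class c ∈ H²(X(ℂ);ℂ) of Hodge type (1,1) lies in algebraicClasses X 1 = N¹H²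
(the span of divisor classes). ROLE: the q = 1 base of the Assembly's induction on codimension (the
'Mordell–Weil bottom' of the thesis); the Assembly currently takes the fact itself as its first
antecedent. HOW TO CLOSE: prove/discharge the fact IN LITERATURE (literature-prover seats), then
close this item by the one-liner `theorem lefschetzOneOne_item :
…CurveNetMordellWeil.LefschetzOneOne := fun n X hX c hc h ↦ <fact>_holds hX c hc h` in Theorems/; do
NOT attempt a problem-side proof of Lefschetz (1,1). REROU -/
@[route_item "route-HodgeConjecture-CurveNetMordellWeil", crux]
def LefschetzOneOne : Prop :=
  ∀ ⦃n : ℕ⦄ ⦃X : Literature.AlgebraicGeometry.Motives.SchemeOver ℂ⦄, Literature.AlgebraicGeometry.Motives.IsSmoothProjective n X → ∀ c : Literature.AlgebraicGeometry.HodgeTheory.complexBetti X (2 * 1), Literature.AlgebraicGeometry.HodgeTheory.IsRationalClass c → Literature.AlgebraicGeometry.HodgeTheory.IsOfHodgeType n X (2 * 1) 1 1 c → c ∈ Literature.AlgebraicGeometry.HodgeTheory.algebraicClasses X 1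

-- earlier Assembly (stmt-HodgeConjecture-2792, replaced 2026-08-15T16:21:31Z -> stmt-HodgeConjecture-10706): retired by None — Literature.AlgebraicGeometry.HodgeTheory.lefschetzOneOne_rational → (∀ (n : ℕ) (X : Literature.AlgebraicGeometry.Motives.SchemeOver ℂ), Literature.AlgebraicGeometry.HodgeTheory.nonempty_hodgeModel n X) → ComplexOrientationExists → CurveNetExists → DeligneDescent → GysinPrese
/-- item stmt-HodgeConjecture-10706 · assembly · rank 1 · closed · proved by Summit.HodgeConjecture.HodgeConjecture.Theorems.curveNetMordellWeil_assembly_proof @ 9832dbd9f3f6 (prover) · by planner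
sources: Sketch.lean (planner folder): theorem assembly_provable, Literature.AlgebraicGeometry.HodgeTheory.lefschetzOneOne_rational, Literature.AlgebraicGeometry.HodgeTheory.nonempty_hodgeModel
[assembly] LefschetzOneOne → HodgeModels → ComplexOrientationExists → CurveNetExists →
DeligneDescent → GysinPreservesAlgebraic → VerticalSupportAboveMiddle → VerticalSupportMiddle →
VerticalSupportBelowMiddle → HodgeConjecture. Restated 2026-08-15 (route-repair): the two Literature
named-fact antecedents of the original assembly (lefschetzOneOne_rational; ∀ n X,
nonempty_hodgeModel n X) are replaced 1:1 by the route's own support items LefschetzOneOne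
(stmt-HodgeConjecture-8544) and HodgeModels (stmt-HodgeConjecture-3050), their verbatim restatements
— nothing else changed. PROVED: this is literally the type of the route's deciding theorem `closes`
(D-0027 §2.1, rendered at the end of this file; strong induction on the codimension q — q = 0
algebraicClasses_zero, q = 1 LefschetzOneOne, q ≥ 2 and n ≤ 1 subsingleton_complexBetti, q ≥ 2 and n
≥ 2: curve net from CurveNetExists, regime split lt_trichotomy (2q) n into the three
vertical-support statements, vertical part through DeligneDescent + induction hypothesis +
GysinPreservesAlgebraic (d + e = q), push-down by σ_* (e = 0), HodgeConjectureFor = ⟨HodgeModels,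
cycle part⟩; lean check rc 0, axioms propext/Classical.choice/Quot.sound) -/
@[route_item "route-HodgeConjecture-CurveNetMordellWeil"]
def Assembly : Prop :=
  LefschetzOneOne → HodgeModels → ComplexOrientationExists → CurveNetExists → DeligneDescent → GysinPreservesAlgebraic → VerticalSupportAboveMiddle → VerticalSupportMiddle → VerticalSupportBelowMiddle → _root_.HodgeConjecture

/-! D-0027 §2.1 — DECIDING THEOREM (planner-authored via `route open/edit --closes-file`; by planner-rbadge-HodgeConjecture-CurveNetMordell-9a58c73d-g3-0 2026-08-17T08:49:59Z):
its hypotheses are this route's items and its conclusion the sub-problem Statement (glue_lint), and it elaborates with this file. -/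

/-- D-0027 §2.1 DECIDING THEOREM of route CurveNetMordellWeil (route-repair 2026-08-17, badge repair after
`skeleton.hides-summit`: the former middle-degree crux `VerticalSupportMiddle` is, as typed, EQUIVALENT to the
Hodge conjecture — tree theorem `Theorems.verticalSupportMiddle_iff_hodgeConjecture` — and is retired to an aside;
its typed decomposition is harvested here). HYPOTHESES = the route's items `LefschetzOneOne`, `HodgeModels`,
`ComplexOrientationExists`, `CurveNetExists`, `DeligneDescent`, `GysinPreservesAlgebraic` (supports; four of
them already proved), the FOURFOLD CRUX `VerticalSupportFourfolds` (vertical support = Mordell–Weil classes of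
Jacobian fibrations over surfaces T ⊂ ℙ³ on a curve-netted fourfold) and the SHARED LADDER CRUX
`SummitGrantedFourfolds` (HC(4;2,2) ⟹ the statement in every dimension; verbatim stmt-HodgeConjecture-14600).
PROOF (pure logic + arithmetic, no import beyond the route file's): (1) HC(4;2,2) for EVERY smooth projective
fourfold X: fix the orientation family μ (`ComplexOrientationExists`); take the curve net (X', σ, pr : X' → ℙ³) of
`CurveNetExists` (n = 4, m = 3); by `VerticalSupportFourfolds` a rational (2,2)-class on X' is algebraic modulo
classes dying off pr⁻¹(T), T ⊊ ℙ³ closed; such a class is, by `DeligneDescent` (ONE descent step), a sum of Gysin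
images of rational (d,d)-classes with d + e = 2, e ≥ 1, i.e. d ≤ 1 — algebraic by `algebraicClasses_zero` (d = 0)
or `LefschetzOneOne` (d = 1) — and Gysin images of algebraic classes are algebraic (`GysinPreservesAlgebraic`);
push down to X by σ_* (`GysinPreservesAlgebraic`, e = 0). (2) `SummitGrantedFourfolds` turns HC(4;2,2) into
`HodgeConjectureFor n X` for all n, X (Hodge models also from `HodgeModels`). No induction on the codimension is
needed any more: the only cycle-producing inputs are Lefschetz (1,1) and the fourfold crux. -/
@[closes "route-HodgeConjecture-CurveNetMordellWeil"] theorem closes (hL11 : LefschetzOneOne) (hModel : HodgeModels) (hOr : ComplexOrientationExists)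
    (hNet : CurveNetExists) (hDesc : DeligneDescent) (hGys : GysinPreservesAlgebraic)
    (hFour : VerticalSupportFourfolds) (hLadder : SummitGrantedFourfolds) : _root_.HodgeConjecture := by
  obtain ⟨μ, hμ⟩ := hOr
  -- (1) HC(4;2,2) for every smooth projective fourfold
  have hc42 : ∀ ⦃X : Literature.AlgebraicGeometry.Motives.SchemeOver ℂ⦄,
      Literature.AlgebraicGeometry.Motives.IsSmoothProjective 4 X →
      ∀ c : Literature.AlgebraicGeometry.HodgeTheory.complexBetti X (2 * 2),
        Literature.AlgebraicGeometry.HodgeTheory.IsRationalClass c →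
        Literature.AlgebraicGeometry.HodgeTheory.IsOfHodgeType 4 X (2 * 2) 2 2 c →
        c ∈ Literature.AlgebraicGeometry.HodgeTheory.algebraicClasses X 2 := by
    intro X hX c hc hh
    obtain ⟨X', hX', σ, pr, hsurj, hle⟩ := hNet μ hμ hX (show 2 ≤ 4 by norm_num) (show 3 + 1 = 4 by norm_num)
    -- vertical rational (2,2)-classes on X' are algebraic: one descent step + Lefschetz (1,1)
    have vert : ∀ c' : Literature.AlgebraicGeometry.HodgeTheory.complexBetti X' (2 * 2),
        Literature.AlgebraicGeometry.HodgeTheory.IsRationalClass c' →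
        Literature.AlgebraicGeometry.HodgeTheory.IsOfHodgeType 4 X' (2 * 2) 2 2 c' →
        ∀ T : Set (Literature.AlgebraicGeometry.Motives.projectiveSpace 3 ℂ).left,
        IsClosed T → T ≠ Set.univ →
        Literature.AlgebraicGeometry.HodgeTheory.complexBetti.restrictCompl X'
          (pr.left.base ⁻¹' T) (2 * 2) c' = 0 →
        c' ∈ Literature.AlgebraicGeometry.HodgeTheory.algebraicClasses X' 2 := by
      intro c' hc' hh' T hT hTne hcT
      have hY : IsClosed (pr.left.base ⁻¹' T) := hT.preimage pr.left.base.hom.continuous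
      have hYne : pr.left.base ⁻¹' T ≠ Set.univ := by
        intro hU
        apply hTne
        refine Set.eq_univ_of_forall fun t => ?_
        obtain ⟨x, rfl⟩ := hsurj t
        have hx : x ∈ pr.left.base ⁻¹' T := by
          rw [hU]
          exact Set.mem_univ x
        exact hx
      have hmem := hDesc μ hμ hX' (pr.left.base ⁻¹' T) hY hYne c' hc' hh' hcT
      have aux : ∀ S : Submodule ℂ (Literature.AlgebraicGeometry.HodgeTheory.complexBetti X' (2 * 2)),
          c' ∈ S → S ≤ Literature.AlgebraicGeometry.HodgeTheory.algebraicClasses X' 2 →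
          c' ∈ Literature.AlgebraicGeometry.HodgeTheory.algebraicClasses X' 2 :=
        fun S h₁ h₂ => h₂ h₁
      refine aux _ hmem ?_
      refine iSup_le fun d => iSup_le fun e => iSup_le fun hde => iSup_le fun he =>
        iSup_le fun W => iSup_le fun m' => iSup_le fun hm => iSup_le fun hW => iSup_le fun g => ?_
      rcases Nat.lt_or_ge d 1 with hd0 | hd1
      · obtain rfl : d = 0 := by omega
        obtain rfl : e = 2 := by omega
        have hd : Submodule.span ℂ
            {b : Literature.AlgebraicGeometry.HodgeTheory.complexBetti W (2 * 0) |
              Literature.AlgebraicGeometry.HodgeTheory.IsRationalClass b ∧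
              Literature.AlgebraicGeometry.HodgeTheory.IsOfHodgeType m' W (2 * 0) 0 0 b} ≤
            Literature.AlgebraicGeometry.HodgeTheory.algebraicClasses W 0 := by
          rw [Literature.AlgebraicGeometry.HodgeTheory.algebraicClasses_zero]
          exact le_top
        exact (Submodule.map_mono hd).trans (hGys μ hμ hW hX' g hm)
      · obtain rfl : d = 1 := by omega
        obtain rfl : e = 1 := by omega
        have hd : Submodule.span ℂ
            {b : Literature.AlgebraicGeometry.HodgeTheory.complexBetti W (2 * 1) |
              Literature.AlgebraicGeometry.HodgeTheory.IsRationalClass b ∧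
              Literature.AlgebraicGeometry.HodgeTheory.IsOfHodgeType m' W (2 * 1) 1 1 b} ≤
            Literature.AlgebraicGeometry.HodgeTheory.algebraicClasses W 1 :=
          Submodule.span_le.2 fun b hb => hL11 hW b hb.1 hb.2
        exact (Submodule.map_mono hd).trans (hGys μ hμ hW hX' g hm)
    -- every rational (2,2)-class on X' is algebraic: the fourfold crux splits it as algebraic + vertical
    have step : Submodule.span ℂ
        {c' : Literature.AlgebraicGeometry.HodgeTheory.complexBetti X' (2 * 2) |
          Literature.AlgebraicGeometry.HodgeTheory.IsRationalClass c' ∧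
          Literature.AlgebraicGeometry.HodgeTheory.IsOfHodgeType 4 X' (2 * 2) 2 2 c'} ≤
        Literature.AlgebraicGeometry.HodgeTheory.algebraicClasses X' 2 := by
      refine (hFour pr hX' hsurj).trans (sup_le le_rfl (Submodule.span_le.2 ?_))
      rintro c' ⟨hc', hh', T, hT, hTne, hcT⟩
      exact vert c' hc' hh' T hT hTne hcT
    -- push down to X along σ (Gysin with e = 0)
    exact ((hle 2).trans ((Submodule.map_mono step).trans
      (hGys μ hμ hX' hX σ (show 4 + 0 = 4 by norm_num)))) (Submodule.subset_span ⟨hc, hh⟩)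
  -- (2) the ladder: HC(4;2,2) ⟹ the statement in every dimension
  intro n X hX
  exact ⟨hModel hX, (hLadder hc42 hX).2⟩

end Summit.HodgeConjecture.HodgeConjecture.Theses.CurveNetMordellWeil
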